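import Summits.SmoothPoincare4.SmoothPoincare4.Theses.WeakReductionDescent
import Summits.SmoothPoincare4.SmoothPoincare4.Theorems.WeakReductionDescentWeakReductionReducesStubLoopFromGenusThreeAux5
import Summits.SmoothPoincare4.SmoothPoincare4.Theorems.WeakReductionDescentWeakReductionReducesStubLoopFromGenusThreeAux6
import Summits.SmoothPoincare4.SmoothPoincare4.Theorems.WeakReductionDescentWeakReductionReducesStubLoopNoDescentFromFiveAux4
import Summits.SmoothPoincare4.SmoothPoincare4.Theorems.WeakReductionDescentWeakReductionReducesStubLoopDichotomyAux2
import Summits.SmoothPoincare4.SmoothPoincare4.Theorems.WeakReductionDescentWeakReductionReducesStubLoopDichotomyFourAux1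
import Summits.SmoothPoincare4.SmoothPoincare4.Theorems.WeakReductionDescentWeakReductionReducesStubLoopDichotomyFromFiveAux1
import Summits.SmoothPoincare4.SmoothPoincare4.Theorems.WeakReductionDescentWeakReductionReducesStubLoopResidueAux1
import Summits.SmoothPoincare4.SmoothPoincare4.Theorems.WeakReductionDescentWeakReductionReducesStubLoopDichotomyFourCoreAux1
import Summits.SmoothPoincare4.SmoothPoincare4.Theorems.WeakReductionDescentWeakReductionReducesStubLoopDichotomyFromFiveCoreAux2
import Summits.SmoothPoincare4.SmoothPoincare4.Theorems.WeakReductionDescentWeakReductionReducesStubLoopDichotomyFromFiveCorePosAux1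
import Literature.Topology.FourManifolds.SphereTrisectionsSectors
import Literature.Topology.FourManifolds.TrisectionFunctorGKNaturality
import Literature.Topology.FourManifolds.WeaklyReducibleTrisections
import Literature.Topology.FourManifolds.CircleSurgery
import Literature.Topology.FourManifolds.SmallTrisectionsChiZeroProofs

/-!
# Crux `WeakReductionDescent.WeakReductionReduces` (stmt-SmoothPoincare4-17908, "K2") — line `loop-dichotomy`,
# skeleton v6 (lead seat c2, 2026-08-17): `WeakReductionReduces ⇐ CORE₄ᵍ ∧ CORE₅ᵍ ∧ MSZ16 Thm 1.2 ∧ H_res′`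

`WeakReductionReduces ⇐ stub_loopDichotomyFourCoreGenuine ∧ stub_loopDichotomyFromFiveCoreGenuine ∧ stub_mszClassification ∧ stub_loopResidueCore`.

K2: for a smooth homotopy 4-sphere `M` (the Statement's bare binders + `e : M ≃ₕ S⁴`) and a weakly
reducible GK-trisection `T` of genus `g ≥ 4` that is of MINIMAL genus for `M`, `T` is reducible.

History.  v1 (crux-strategist, sha 1ff30cc0…): K2 ⇐ D ∧ L₃ ∧ L₅ (D = untelescoping TRICHOTOMY of a
weak reduction WITHOUT minimality — reducible ∨ smaller trisection of `M` ∨ `M = X_ℓ` a loop surgery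
on a smaller-genus trisected `X`; Aranda–Zupan 2025 Thm 1.3/§5 one genus up).  v2 (lead seat -0,
sha 60d2a679…): L₃, L₅ derived from ONE MSZ named fact + typed residue H_res (21 accepted files).
v3 (this seat, sha 66732100…): MSZ debt re-pinned to the root node `msz_trisection_classification_gk`;
D weakened to `g ≥ 4` and cut to the non-MSZ types by the PROVED `Σ kᵢ = g` and the classification
(glue `helper_loopDichotomy_fromFour_of_core`, Theorems …StubLoopDichotomyAux2, p167078): D₄ (genus 4,
types `(2,1,1)`/`(2,2,0)`) and D₅ (genus `≥ 5`).

v4 (this file, after wave 1 — three accepted `--supports` files) cuts each open stub to its CORE: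

* `stub_loopDichotomyFourCore` (CORE₄) / `stub_loopDichotomyFromFiveCore` (CORE₅) — D₄ / D₅ for
  trisections that are NOT reducible and whose weak reduction has FIXED LABELS (`c` compressing in
  `H₀ = T 1 ∩ T 2`, `c′` in `H₁` and `H₂`, i.e. `c′` is a non-separating reducing curve of the
  genus-`g` Heegaard splitting `H₁ ∪_F H₂ = ∂(T 0) ≅ #^{k₀}(S¹ × S²)`), conclusion "smaller
  trisection of `M` ∨ loop surgery on a smaller-genus trisected `X`" — Aranda–Zupan's own opening
  move (§2 p. 6, §6 p. 20); glue `helper_loopDichotomyFour_of_irreducibleCore` (…FourAux1, p168692) and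
  `helper_loopDichotomyFromFive_of_irreducibleCore` (…FromFiveAux1, p167845), PROVED by relabelling
  (`IsGKTrisection.comp_perm`, `Trisection.*_comp_perm`, `isReducible_comp_perm`).  These are exactly
  "Aranda–Zupan Thm 1.3, first sentence, one genus (and more) up, for homotopy spheres" followed by
  the general-genus §5 (five-chain surgery ⇒ loop surgery) — the same shape in which the barrier
  catalogue leaves the genus-THREE fact (`az2025_irreducibleCore_zero_of_loopSurgery_of_fiveChainSurgery`).
* `stub_mszClassification` — unchanged (MSZ16 Thm 1.2, the tree's consolidated named fact;
  formalisation debt: Waldhausen, Laudenbach–Poénaru, GK Lemma 13, MSZ Thm 5.1, genus-one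
  classification — lit-prover verdict 2026-08-17: XL apex).
* `stub_loopResidueCore` (H_res′) — H_res restricted to the loop partners that survive Chu–Tillmann's
  per-sector rank bound and `χ(X) = 0 ⇒ π₁(X) ≠ 1`: extra hypotheses `∀ i, 1 ≤ k′ᵢ`,
  `∀ x, Nontrivial (π₁(X, x))`, `∀ i x, ∃ φ : F_{k′ᵢ} ↠ π₁(X, x)`; glue `helper_loopResidue_of_lowRank`
  (…StubLoopResidueAux1, p168356), PROVED from the tree's van Kampen / AGK (a′) inputs — no named fact.

v5 (this file, after wave 2 — three more accepted `--supports` files) adds the STRUCTURAL LEMMA of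
the weak reduction and the type normal form:

* `helper_one_le_kZero_of_doublyCompressing` (…StubLoopDichotomyFromFiveCoreAux0/Aux1, p169652 /
  p169877; wave-2 worker): for ANY GK-trisection, a non-separating curve of the central surface that
  compresses in both `H₁` and `H₂` forces `1 ≤ k 0` — PROVED from the tree's side functions of the
  two discs, the winding homomorphism on `π₁(F)`, and (T2)/(T3) of Abrams–Gay–Kirby
  (`π₁(F) ↠ π₁(∂X₀) ≅ F_{k₀}` with kernel `⟪K₁ ∪ K₂⟫`).  With the labels fixed this is "`c′` is a
  non-separating reducing curve of `∂(T 0) ≅ #^{k₀}(S¹ × S²)`, so `k₀ ≥ 1`" (Aranda–Zupan p. 21).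
* hence the NORMAL FORM of the type: `stub_loopDichotomyFourCoreNorm` (CORE₄ⁿ = CORE₄ with `1 ≤ k 0`
  and `k 2 ≤ k 1`, the latter by the relabelling `(1 2)` which fixes `H₀`; glue
  `helper_loopDichotomyFourCore_of_normalised`, …FourCoreAux1, p170417) — at genus 4 exactly the THREE
  types `(k₀; k₁,k₂) = (1; 2,1), (2; 1,1), (2; 2,0)` remain (the type `(0; 2,2)` is vacuous) — and
  `stub_loopDichotomyFromFiveCorePos` (CORE₅⁺ = CORE₅ with `1 ≤ k 0`; glue
  `helper_loopDichotomyFromFiveCore_of_posFirst`, …FromFiveCoreAux2, p170062; the further normal form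
  `k 2 ≤ k 1` is LANDED as `helper_loopDichotomyFromFiveCorePos_of_normalised`, …FromFiveCorePosAux1,
  p170649, and is to be folded in at the next reshape once the farm has built that module).
* `stub_mszClassification`, `stub_loopResidueCore` — unchanged (wave 2 on H_res′: the pruning to
  `g ≤ g′ + 2` would need "g(X_ℓ) ≤ g(X) + 2 for BOTH framings and every loop", which is NOT in
  print — AZ25 Thm 5.1 = AM22 Thm 7.1 give one sibling for single-arc decomposed curves only;
  nothing vendored; AM22 now held, acq-07407).

v6 (this file, lead seat c2) folds in the landed normal form `k 2 ≤ k 1` at rungs `≥ 5`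
(`helper_loopDichotomyFromFiveCorePos_of_normalised`, …FromFiveCorePosAux1, p170649: CORE₅ⁿ → CORE₅⁺)
and cuts BOTH cores by the normal form of a weak reduction of a homotopy sphere: since
`π₁(M) = 1` (`M ≃ₕ S⁴`; `simplyConnectedSpace_sphere_four_holds`, PROVED) and a non-separating curve
compressing in all three handlebodies forces `π₁ ≠ 1`
(`Trisection.not_simplyConnectedSpace_of_reducing_nonseparating`, PROVED tree theorem), NEITHER
curve of the weak reduction is a reducing curve — `c′` does not compress in `H₀`, `c` does not
compress in both `H₁` and `H₂` (glue `genuine_of_weakReduction` below, sorry-free; the same facts and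
the relabelled structural lemma — `c` compressing also in `H₁` ⇒ `1 ≤ k 2`, also in `H₂` ⇒ `1 ≤ k 1` —
are LANDED as the toolkit `helper_weakReduction_normalForm`, …StubLoopDichotomyCoreToolkit, p172379;
the glue itself as `helper_loopDichotomyFourCoreNorm_of_genuine` / `helper_loopDichotomyFromFiveCoreNorm_of_genuine`,
…StubLoopDichotomyCoreGenuineAux1, p172908, together with the RUNG-4 MILESTONE
`helper_rungFour_of_coreFourGenuine_msz : CORE₄ᵍ → MSZ16 Thm 1.2 → K2 at genus 4` — a minimal weakly
reducible `(4; k)`-GK-trisection of a homotopy sphere is reducible GIVEN the genuine core at genus 4 and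
the classification; rungs `≥ 5` additionally need CORE₅ᵍ and H_res′).
The new stubs CORE₄ᵍ `stub_loopDichotomyFourCoreGenuine` / CORE₅ᵍ `stub_loopDichotomyFromFiveCoreGenuine`
carry these two facts as hypotheses (they are what any proof uses first: the weak reduction is
GENUINE); `loopDichotomyFourCoreNorm` (v5 CORE₄ⁿ verbatim) and `loopDichotomyFromFiveCoreNorm` (CORE₅ⁿ)
are derived from them, and everything downstream is v5 verbatim.  At genus 4 the three types and
their handle readings (GK Lemma 13) are: `(2;2,0)` — `T 2 ≅ B⁴`, `M = B⁴ ∪ 2 two-handles ∪ 2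
three-handles ∪ B⁴` (a 2-component R-link of tunnel number ≤ 3 — tunnel number ≤ 2 is covered in
print, MSZ16 Cor. 1.3 / Meier–Zupan 2018 Thm 1.2; τ = 3 is Generalised Property R / GST territory), where moreover `c` compresses in `H₀` only or in `H₀` and `H₂` (toolkit, `k 2 = 0`);
`(2;1,1)` and `(1;2,1)` — one 1-handle, two 2-handles, one 3-handle (`π₁`-presentation
`⟨x | r₁, r₂⟩`, AZ25 §6 cases (7)–(9) / [Gab87] territory).  None is closable from print (presearch
in NOTES.md); the cores are "Aranda–Zupan Thm 1.3, first sentence, one genus (and more) up".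

Composition: as v3 — `WeakReductionReduces_of = weakReductionReduces_of_pieces' D(≥4) L₃ L₅` with
`D(≥4) := helper_loopDichotomy_fromFour_of_core MSZ (…Four_of_irreducibleCore CORE₄) (…FromFive_of_irreducibleCore CORE₅)`,
`L₃ := helper_loopFromGenusThree_of_msz (msz_chiZero…_of_classification MSZ)`,
`L₅ := helper_loopNoDescentFromFive_of_msz (helper_mszLoopSurgery_of_chiZero …) (helper_loopResidue_of_lowRank H_res′)`.
`CORE₄ := …FourCore_of_normalised (…FourCoreNorm ⇐ CORE₄ᵍ)`, `CORE₅ := …FromFiveCore_of_posFirst (…CorePos_of_normalised (CORE₅ⁿ ⇐ CORE₅ᵍ))`.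
Sorries: exactly the four stubs; all SPC4-implied (the cores through the genus-`0` trisection of
`S⁴` / vacuity of minimality; the classification a theorem in print); none is the crux or the summit
in disguise.
-/

noncomputable section

set_option linter.dupNamespace false

open scoped Manifold ContDiff Topology ContinuousMap
open Set
open Literature.Topology.FourManifolds
open Summit.SmoothPoincare4.SmoothPoincare4.Theses.WeakReductionDescent
open Summit.SmoothPoincare4.SmoothPoincare4.Theorems.WeakReductionReduces.LoopDichotomy

namespace Summit.SmoothPoincare4.SmoothPoincare4.Cruxes.WeakReductionReduces.LoopDichotomy

/-! ## The four stubs (registered; v6) -/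

/-- **CORE₄ᵍ — `stub_loopDichotomyFourCoreGenuine` (crux-strength; "Aranda–Zupan Thm 1.3 at genus 4 for
homotopy spheres", irreducible fixed-label GENUINE weak reduction, normalised type, no minimality).**
Let `M` be a smooth homotopy 4-sphere and `T` a `(4; k)`-GK-trisection of type
`(k₀; k₁,k₂) ∈ {(1;2,1), (2;1,1), (2;2,0)}` (`Σ kᵢ = 4`, `kᵢ ≤ 2`, `1 ≤ k₀`, `k₂ ≤ k₁`), carrying a
weak reduction with fixed labels (`c` compresses in `H₀`, `c′` in `H₁` and `H₂`; disjoint,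
non-separating) which is GENUINE (`c′` does not compress in `H₀`; `c` does not compress in both `H₁`
and `H₂` — free for homotopy spheres, `genuine_of_weakReduction`) and NO reducing curve.  Then `M`
has a GK-trisection of genus `< 4`, or `M` is surgery on a smoothly embedded loop in a smooth closed
4-manifold with a GK-trisection of genus `< 4` (printed mechanism at genus 3: such a `T` contains a
five-chain, and five-chain surgery is a loop surgery on a `(g−1; k₀′,k₁′,k₂′)`-trisected `X′`).
[cite: ArandaZupan2025, Thm. 1.3 (p. 2), §5 Lemma 5.4 / Prop. 5.5, §6 (p. 20)] -/
theorem stub_loopDichotomyFourCoreGenuine :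
    ∀ (M : Type) [TopologicalSpace M] [T2Space M] [SecondCountableTopology M] [ChartedSpace (EuclideanSpace ℝ (Fin 4)) M] [IsManifold (𝓡 4) ((⊤ : ℕ∞) : WithTop ℕ∞) M], (M ≃ₕ (Metric.sphere (0 : EuclideanSpace ℝ (Fin 5)) 1)) → ∀ (k : Fin 3 → ℕ) (T : Fin 3 → Set M), Literature.Topology.FourManifolds.IsGKTrisection M 4 k T → k 0 + k 1 + k 2 = 4 → (∀ i, k i ≤ 2) → 1 ≤ k 0 → k 2 ≤ k 1 → (∃ c c' : Set M, Literature.Topology.FourManifolds.Trisection.IsCurve T c ∧ Literature.Topology.FourManifolds.Trisection.IsCurve T c' ∧ Disjoint c c' ∧ Literature.Topology.FourManifolds.Trisection.IsNonSeparating T c ∧ Literature.Topology.FourManifolds.Trisection.IsNonSeparating T c' ∧ Literature.Topology.FourManifolds.Trisection.BoundsDisc T (Literature.Topology.FourManifolds.Trisection.spineHandlebody T 0) c ∧ Literature.Topology.FourManifolds.Trisection.BoundsDisc T (Literature.Topology.FourManifolds.Trisection.spineHandlebody T 1) c' ∧ Literature.Topology.FourManifolds.Trisection.BoundsDisc T (Literature.Topology.FourManifolds.Trisection.spineHandlebody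 T 2) c' ∧ ¬ Literature.Topology.FourManifolds.Trisection.BoundsDisc T (Literature.Topology.FourManifolds.Trisection.spineHandlebody T 0) c' ∧ ¬ (Literature.Topology.FourManifolds.Trisection.BoundsDisc T (Literature.Topology.FourManifolds.Trisection.spineHandlebody T 1) c ∧ Literature.Topology.FourManifolds.Trisection.BoundsDisc T (Literature.Topology.FourManifolds.Trisection.spineHandlebody T 2) c)) → ¬ Literature.Topology.FourManifolds.Trisection.IsReducible T → (∃ (g₁ : ℕ) (k₁ : Fin 3 → ℕ) (T₁ : Fin 3 → Set M), g₁ < 4 ∧ Literature.Topology.FourManifolds.IsGKTrisection M g₁ k₁ T₁) ∨ (∃ (X : Type) (_ : TopologicalSpace X) (_ : T2Space X) (_ : SecondCountableTopology X) (_ : ChartedSpace (EuclideanSpace ℝ (Fin 4)) X) (_ : IsManifold (𝓡 4) ((⊤ : ℕ∞) : WithTop ℕ∞) X) (g' : ℕ) (k' : Fin 3 → ℕ) (T' : Fin 3 → Set X) (ℓ : (Metric.sphere (0 : EuclideanSpace ℝ (Fin 2)) 1) → X), g' < 4 ∧ Literature.Topology.FourManifolds.IsGKTrisection X g' k' T'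 ∧ Manifold.IsSmoothEmbedding (𝓡 1) (𝓡 4) ((⊤ : ℕ∞) : WithTop ℕ∞) ℓ ∧ Literature.Topology.FourManifolds.IsCircleSurgery (𝓡 4) (𝓡 4) X M ℓ) := by
  sorry

/-- **CORE₅ᵍ — `stub_loopDichotomyFromFiveCoreGenuine` (crux-strength; the same at rungs `≥ 5`:
non-MSZ types `Σ kᵢ = g`, all `kᵢ + 2 ≤ g`, normalised `1 ≤ k₀`, `k₂ ≤ k₁`, genuine fixed-label weak
reduction, no reducing curve).** [cite: ArandaZupan2025, Thm. 1.3 (p. 2), §5, §6 (p. 20)] -/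
theorem stub_loopDichotomyFromFiveCoreGenuine :
    ∀ (M : Type) [TopologicalSpace M] [T2Space M] [SecondCountableTopology M] [ChartedSpace (EuclideanSpace ℝ (Fin 4)) M] [IsManifold (𝓡 4) ((⊤ : ℕ∞) : WithTop ℕ∞) M], (M ≃ₕ (Metric.sphere (0 : EuclideanSpace ℝ (Fin 5)) 1)) → ∀ (g : ℕ) (k : Fin 3 → ℕ) (T : Fin 3 → Set M), Literature.Topology.FourManifolds.IsGKTrisection M g k T → 5 ≤ g → k 0 + k 1 + k 2 = g → (∀ i, k i + 2 ≤ g) → 1 ≤ k 0 → k 2 ≤ k 1 → (∃ c c' : Set M, Literature.Topology.FourManifolds.Trisection.IsCurve T c ∧ Literature.Topology.FourManifolds.Trisection.IsCurve T c' ∧ Disjoint c c' ∧ Literature.Topology.FourManifolds.Trisection.IsNonSeparating T c ∧ Literature.Topology.FourManifolds.Trisection.IsNonSeparating T c' ∧ Literature.Topology.FourManifolds.Trisection.BoundsDisc T (Literature.Topology.FourManifolds.Trisection.spineHandlebody T 0) c ∧ Literature.Topology.FourManifolds.Trisection.BoundsDisc T (Literature.Topology.FourManifolds.Trisection.spineHandlebody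 T 1) c' ∧ Literature.Topology.FourManifolds.Trisection.BoundsDisc T (Literature.Topology.FourManifolds.Trisection.spineHandlebody T 2) c' ∧ ¬ Literature.Topology.FourManifolds.Trisection.BoundsDisc T (Literature.Topology.FourManifolds.Trisection.spineHandlebody T 0) c' ∧ ¬ (Literature.Topology.FourManifolds.Trisection.BoundsDisc T (Literature.Topology.FourManifolds.Trisection.spineHandlebody T 1) c ∧ Literature.Topology.FourManifolds.Trisection.BoundsDisc T (Literature.Topology.FourManifolds.Trisection.spineHandlebody T 2) c)) → ¬ Literature.Topology.FourManifolds.Trisection.IsReducible T → (∃ (g₁ : ℕ) (k₁ : Fin 3 → ℕ) (T₁ : Fin 3 → Set M), g₁ < g ∧ Literature.Topology.FourManifolds.IsGKTrisection M g₁ k₁ T₁) ∨ (∃ (X : Type) (_ : TopologicalSpace X) (_ : T2Space X) (_ : SecondCountableTopology X) (_ : ChartedSpace (EuclideanSpace ℝ (Fin 4)) X) (_ : IsManifold (𝓡 4) ((⊤ : ℕ∞) : WithTop ℕ∞) X) (g' : ℕ) (k' : Fin 3 → ℕ) (T' : Fin 3 → Set X) (ℓ : (Metric.sphere (0 : EuclideanSpace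 ℝ (Fin 2)) 1) → X), g' < g ∧ Literature.Topology.FourManifolds.IsGKTrisection X g' k' T' ∧ Manifold.IsSmoothEmbedding (𝓡 1) (𝓡 4) ((⊤ : ℕ∞) : WithTop ℕ∞) ℓ ∧ Literature.Topology.FourManifolds.IsCircleSurgery (𝓡 4) (𝓡 4) X M ℓ) := by
  sorry

/-- **`stub_mszClassification` — Meier–Schirmer–Zupan 2016, Thm 1.2 (arXiv numbering), as the
tree's consolidated NAMED FACT `Literature.Topology.FourManifolds.msz_trisection_classification_gk`
(universe 0).**  Formalisation debt, not open mathematics.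
[cite: MeierSchirmerZupan2016, Thm. 1.2 (arXiv numbering; proof §5 via Thm. 5.1)] -/
theorem stub_mszClassification :
    Literature.Topology.FourManifolds.msz_trisection_classification_gk.{0} := by
  sorry

/-- **H_res′ — `stub_loopResidueCore` (crux-strength, SPC4-shielded): the loop-surgery residue after
Chu–Tillmann pruning.**  A smooth homotopy 4-sphere `M` of minimal trisection genus `g ≥ 5` is not a
surgery on a smoothly embedded loop in an ORIENTED closed smooth `X` carrying a `(g′; k′)`-GK-
trisection with `4 ≤ g′ < g`, `Σ k′ = g′ + 2` (`χ(X) = 0`), all `k′ᵢ + 2 ≤ g′`, all `k′ᵢ ≥ 1`,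
`π₁(X) ≠ 1` and `F_{k′ᵢ} ↠ π₁(X, x)` for all `i`, `x`.  [folklore] (statement of the open residue; no source proves it) -/
theorem stub_loopResidueCore :
    ∀ (M : Type) [TopologicalSpace M] [T2Space M] [SecondCountableTopology M] [ChartedSpace (EuclideanSpace ℝ (Fin 4)) M] [IsManifold (𝓡 4) ∞ M], (M ≃ₕ (Metric.sphere (0 : EuclideanSpace ℝ (Fin 5)) 1)) → ∀ (g : ℕ) (k : Fin 3 → ℕ) (T : Fin 3 → Set M), Literature.Topology.FourManifolds.IsGKTrisection M g k T → 5 ≤ g → (∀ (g'' : ℕ) (k'' : Fin 3 → ℕ) (T'' : Fin 3 → Set M), Literature.Topology.FourManifolds.IsGKTrisection M g'' k'' T'' → g ≤ g'') → ∀ (X : Type) [TopologicalSpace X] [T2Space X] [SecondCountableTopology X] [ChartedSpace (EuclideanSpace ℝ (Fin 4)) X] [IsManifold (𝓡 4) ∞ X], Literature.Topology.FourManifolds.IsOrientable (𝓡 4) X → ∀ (g' : ℕ) (k' : Fin 3 → ℕ) (T' : Fin 3 → Set X), 4 ≤ g' → g' < g → Literature.Topology.FourManifolds.IsGKTrisection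 X g' k' T' → k' 0 + k' 1 + k' 2 = g' + 2 → (∀ i, k' i + 2 ≤ g') → (∀ i, 1 ≤ k' i) → (∀ x : X, Nontrivial (FundamentalGroup X x)) → (∀ (i : Fin 3) (x : X), ∃ φ : FreeGroup (Fin (k' i)) →* FundamentalGroup X x, Function.Surjective φ) → ∀ (ℓ : (Metric.sphere (0 : EuclideanSpace ℝ (Fin 2)) 1) → X), Manifold.IsSmoothEmbedding (𝓡 1) (𝓡 4) ∞ ℓ → ¬ Literature.Topology.FourManifolds.IsCircleSurgery (𝓡 4) (𝓡 4) X M ℓ := by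
  sorry

/-! ## The derived pieces (genuine glue, CORE₄ⁿ, CORE₅ⁿ, CORE₅⁺, CORE₄, CORE₅, D₄, D₅, D at `g ≥ 4`, L₃, H_res, L₅), sorry-free modulo the stubs -/

/-- Local notation: the round `4`-sphere. -/
local notation "𝕊⁴" => (Metric.sphere (0 : EuclideanSpace ℝ (Fin 5)) 1)


/-- **The weak reduction of a homotopy sphere is genuine** (v6 glue, PROVED): neither curve is a
reducing curve — `c′` does not compress in `H₀` and `c` does not compress in both `H₁` and `H₂` —
because a non-separating curve compressing in all three handlebodies forces `π₁(M) ≠ 1`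
(`Trisection.not_simplyConnectedSpace_of_reducing_nonseparating`) while `M ≃ₕ S⁴` is simply
connected. [cite: ArandaZupan2025, §2 (p. 6)] [cite: HatcherAT2002, Prop. 1.26] -/
theorem genuine_of_weakReduction {M : Type} [TopologicalSpace M] [T2Space M]
    [SecondCountableTopology M] [ChartedSpace (EuclideanSpace ℝ (Fin 4)) M] [IsManifold (𝓡 4) ∞ M]
    (e : M ≃ₕ 𝕊⁴) {g : ℕ} {k : Fin 3 → ℕ} {T : Fin 3 → Set M} (hT : IsGKTrisection M g k T)
    {c c' : Set M} (hc : Trisection.IsCurve T c) (hc' : Trisection.IsCurve T c')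
    (hn : Trisection.IsNonSeparating T c) (hn' : Trisection.IsNonSeparating T c')
    (hb0 : Trisection.BoundsDisc T (Trisection.spineHandlebody T 0) c)
    (hb1 : Trisection.BoundsDisc T (Trisection.spineHandlebody T 1) c')
    (hb2 : Trisection.BoundsDisc T (Trisection.spineHandlebody T 2) c') :
    ¬ Trisection.BoundsDisc T (Trisection.spineHandlebody T 0) c' ∧
      ¬ (Trisection.BoundsDisc T (Trisection.spineHandlebody T 1) c ∧
          Trisection.BoundsDisc T (Trisection.spineHandlebody T 2) c) := by
  haveI : SimplyConnectedSpace 𝕊⁴ := simplyConnectedSpace_sphere_four_holds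
  haveI : SimplyConnectedSpace M := e.simplyConnectedSpace
  refine ⟨fun h0 => ?_, fun h12 => ?_⟩
  · refine Trisection.not_simplyConnectedSpace_of_reducing_nonseparating hT hc' (fun q => ?_) hn' ‹_›
    fin_cases q
    · exact h0
    · exact hb1
    · exact hb2
  · refine Trisection.not_simplyConnectedSpace_of_reducing_nonseparating hT hc (fun q => ?_) hn ‹_›
    fin_cases q
    · exact hb0
    · exact h12.1
    · exact h12.2

/-- **CORE₄ⁿ (v5 stub `stub_loopDichotomyFourCoreNorm`, verbatim)** from CORE₄ᵍ (`genuine_of_weakReduction`).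
[cite: ArandaZupan2025, §2 (p. 6), §6 (pp. 20–21)] -/
theorem loopDichotomyFourCoreNorm :
    ∀ (M : Type) [TopologicalSpace M] [T2Space M] [SecondCountableTopology M] [ChartedSpace (EuclideanSpace ℝ (Fin 4)) M] [IsManifold (𝓡 4) ((⊤ : ℕ∞) : WithTop ℕ∞) M], (M ≃ₕ (Metric.sphere (0 : EuclideanSpace ℝ (Fin 5)) 1)) → ∀ (k : Fin 3 → ℕ) (T : Fin 3 → Set M), Literature.Topology.FourManifolds.IsGKTrisection M 4 k T → k 0 + k 1 + k 2 = 4 → (∀ i, k i ≤ 2) → 1 ≤ k 0 → k 2 ≤ k 1 → (∃ c c' : Set M, Literature.Topology.FourManifolds.Trisection.IsCurve T c ∧ Literature.Topology.FourManifolds.Trisection.IsCurve T c' ∧ Disjoint c c' ∧ Literature.Topology.FourManifolds.Trisection.IsNonSeparating T c ∧ Literature.Topology.FourManifolds.Trisection.IsNonSeparating T c' ∧ Literature.Topology.FourManifolds.Trisection.BoundsDisc T (Literature.Topology.FourManifolds.Trisection.spineHandlebody T 0) c ∧ Literature.Topology.FourManifolds.Trisection.BoundsDisc T (Literature.Topology.FourManifolds.Trisection.spineHandlebody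 T 1) c' ∧ Literature.Topology.FourManifolds.Trisection.BoundsDisc T (Literature.Topology.FourManifolds.Trisection.spineHandlebody T 2) c') → ¬ Literature.Topology.FourManifolds.Trisection.IsReducible T → (∃ (g₁ : ℕ) (k₁ : Fin 3 → ℕ) (T₁ : Fin 3 → Set M), g₁ < 4 ∧ Literature.Topology.FourManifolds.IsGKTrisection M g₁ k₁ T₁) ∨ (∃ (X : Type) (_ : TopologicalSpace X) (_ : T2Space X) (_ : SecondCountableTopology X) (_ : ChartedSpace (EuclideanSpace ℝ (Fin 4)) X) (_ : IsManifold (𝓡 4) ((⊤ : ℕ∞) : WithTop ℕ∞) X) (g' : ℕ) (k' : Fin 3 → ℕ) (T' : Fin 3 → Set X) (ℓ : (Metric.sphere (0 : EuclideanSpace ℝ (Fin 2)) 1) → X), g' < 4 ∧ Literature.Topology.FourManifolds.IsGKTrisection X g' k' T' ∧ Manifold.IsSmoothEmbedding (𝓡 1) (𝓡 4) ((⊤ : ℕ∞) : WithTop ℕ∞) ℓ ∧ Literature.Topology.FourManifolds.IsCircleSurgery (𝓡 4) (𝓡 4) X M ℓ) := by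
  intro M _ _ _ _ _ e k T hT hsum hk hk0 h21 hwr hirr
  obtain ⟨c, c', hc, hc', hd, hn, hn', hb0, hb1, hb2⟩ := hwr
  obtain ⟨hg0, hg12⟩ := genuine_of_weakReduction e hT hc hc' hn hn' hb0 hb1 hb2
  exact stub_loopDichotomyFourCoreGenuine M e k T hT hsum hk hk0 h21
    ⟨c, c', hc, hc', hd, hn, hn', hb0, hb1, hb2, hg0, hg12⟩ hirr

/-- **CORE₅ⁿ (the hypothesis of the landed `helper_loopDichotomyFromFiveCorePos_of_normalised`,
verbatim)** from CORE₅ᵍ (`genuine_of_weakReduction`). [cite: ArandaZupan2025, §2 (p. 6), §6 (pp. 20–21)] -/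
theorem loopDichotomyFromFiveCoreNorm :
    ∀ (M : Type) [TopologicalSpace M] [T2Space M] [SecondCountableTopology M] [ChartedSpace (EuclideanSpace ℝ (Fin 4)) M] [IsManifold (𝓡 4) ((⊤ : ℕ∞) : WithTop ℕ∞) M], (M ≃ₕ (Metric.sphere (0 : EuclideanSpace ℝ (Fin 5)) 1)) → ∀ (g : ℕ) (k : Fin 3 → ℕ) (T : Fin 3 → Set M), Literature.Topology.FourManifolds.IsGKTrisection M g k T → 5 ≤ g → k 0 + k 1 + k 2 = g → (∀ i, k i + 2 ≤ g) → 1 ≤ k 0 → k 2 ≤ k 1 → (∃ c c' : Set M, Literature.Topology.FourManifolds.Trisection.IsCurve T c ∧ Literature.Topology.FourManifolds.Trisection.IsCurve T c' ∧ Disjoint c c' ∧ Literature.Topology.FourManifolds.Trisection.IsNonSeparating T c ∧ Literature.Topology.FourManifolds.Trisection.IsNonSeparating T c' ∧ Literature.Topology.FourManifolds.Trisection.BoundsDisc T (Literature.Topology.FourManifolds.Trisection.spineHandlebody T 0) c ∧ Literature.Topology.FourManifolds.Trisection.BoundsDisc T (Literature.Topology.FourManifolds.Trisection.spineHandlebody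 T 1) c' ∧ Literature.Topology.FourManifolds.Trisection.BoundsDisc T (Literature.Topology.FourManifolds.Trisection.spineHandlebody T 2) c') → ¬ Literature.Topology.FourManifolds.Trisection.IsReducible T → (∃ (g₁ : ℕ) (k₁ : Fin 3 → ℕ) (T₁ : Fin 3 → Set M), g₁ < g ∧ Literature.Topology.FourManifolds.IsGKTrisection M g₁ k₁ T₁) ∨ (∃ (X : Type) (_ : TopologicalSpace X) (_ : T2Space X) (_ : SecondCountableTopology X) (_ : ChartedSpace (EuclideanSpace ℝ (Fin 4)) X) (_ : IsManifold (𝓡 4) ((⊤ : ℕ∞) : WithTop ℕ∞) X) (g' : ℕ) (k' : Fin 3 → ℕ) (T' : Fin 3 → Set X) (ℓ : (Metric.sphere (0 : EuclideanSpace ℝ (Fin 2)) 1) → X), g' < g ∧ Literature.Topology.FourManifolds.IsGKTrisection X g' k' T' ∧ Manifold.IsSmoothEmbedding (𝓡 1) (𝓡 4) ((⊤ : ℕ∞) : WithTop ℕ∞) ℓ ∧ Literature.Topology.FourManifolds.IsCircleSurgery (𝓡 4) (𝓡 4) X M ℓ) := by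
  intro M _ _ _ _ _ e g k T hT hg hsum hk hk0 h21 hwr hirr
  obtain ⟨c, c', hc, hc', hd, hn, hn', hb0, hb1, hb2⟩ := hwr
  obtain ⟨hg0, hg12⟩ := genuine_of_weakReduction e hT hc hc' hn hn' hb0 hb1 hb2
  exact stub_loopDichotomyFromFiveCoreGenuine M e g k T hT hg hsum hk hk0 h21
    ⟨c, c', hc, hc', hd, hn, hn', hb0, hb1, hb2, hg0, hg12⟩ hirr

/-- **CORE₅⁺ (v5 stub `stub_loopDichotomyFromFiveCorePos`, verbatim)** from CORE₅ⁿ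
(`helper_loopDichotomyFromFiveCorePos_of_normalised`, PROVED, p170649). [cite: ArandaZupan2025, §2 (p. 6)] -/
theorem loopDichotomyFromFiveCorePos :
    ∀ (M : Type) [TopologicalSpace M] [T2Space M] [SecondCountableTopology M] [ChartedSpace (EuclideanSpace ℝ (Fin 4)) M] [IsManifold (𝓡 4) ((⊤ : ℕ∞) : WithTop ℕ∞) M], (M ≃ₕ (Metric.sphere (0 : EuclideanSpace ℝ (Fin 5)) 1)) → ∀ (g : ℕ) (k : Fin 3 → ℕ) (T : Fin 3 → Set M), Literature.Topology.FourManifolds.IsGKTrisection M g k T → 5 ≤ g → k 0 + k 1 + k 2 = g → (∀ i, k i + 2 ≤ g) → 1 ≤ k 0 → (∃ c c' : Set M, Literature.Topology.FourManifolds.Trisection.IsCurve T c ∧ Literature.Topology.FourManifolds.Trisection.IsCurve T c' ∧ Disjoint c c' ∧ Literature.Topology.FourManifolds.Trisection.IsNonSeparating T c ∧ Literature.Topology.FourManifolds.Trisection.IsNonSeparating T c' ∧ Literature.Topology.FourManifolds.Trisection.BoundsDisc T (Literature.Topology.FourManifolds.Trisection.spineHandlebody T 0) c ∧ Literature.Topology.FourManifolds.Trisection.BoundsDisc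 T (Literature.Topology.FourManifolds.Trisection.spineHandlebody T 1) c' ∧ Literature.Topology.FourManifolds.Trisection.BoundsDisc T (Literature.Topology.FourManifolds.Trisection.spineHandlebody T 2) c') → ¬ Literature.Topology.FourManifolds.Trisection.IsReducible T → (∃ (g₁ : ℕ) (k₁ : Fin 3 → ℕ) (T₁ : Fin 3 → Set M), g₁ < g ∧ Literature.Topology.FourManifolds.IsGKTrisection M g₁ k₁ T₁) ∨ (∃ (X : Type) (_ : TopologicalSpace X) (_ : T2Space X) (_ : SecondCountableTopology X) (_ : ChartedSpace (EuclideanSpace ℝ (Fin 4)) X) (_ : IsManifold (𝓡 4) ((⊤ : ℕ∞) : WithTop ℕ∞) X) (g' : ℕ) (k' : Fin 3 → ℕ) (T' : Fin 3 → Set X) (ℓ : (Metric.sphere (0 : EuclideanSpace ℝ (Fin 2)) 1) → X), g' < g ∧ Literature.Topology.FourManifolds.IsGKTrisection X g' k' T' ∧ Manifold.IsSmoothEmbedding (𝓡 1) (𝓡 4) ((⊤ : ℕ∞) : WithTop ℕ∞) ℓ ∧ Literature.Topology.FourManifolds.IsCircleSurgery (𝓡 4) (𝓡 4) X M ℓ)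 :=
  helper_loopDichotomyFromFiveCorePos_of_normalised loopDichotomyFromFiveCoreNorm

/-- **CORE₄ (v4 stub `stub_loopDichotomyFourCore`, verbatim)** from CORE₄ⁿ (`helper_loopDichotomyFourCore_of_normalised`, PROVED).
[cite: ArandaZupan2025, §2 (p. 6), §6 (pp. 20–21)] -/
theorem loopDichotomyFourCore :
    ∀ (M : Type) [TopologicalSpace M] [T2Space M] [SecondCountableTopology M] [ChartedSpace (EuclideanSpace ℝ (Fin 4)) M] [IsManifold (𝓡 4) ((⊤ : ℕ∞) : WithTop ℕ∞) M], (M ≃ₕ (Metric.sphere (0 : EuclideanSpace ℝ (Fin 5)) 1)) → ∀ (k : Fin 3 → ℕ) (T : Fin 3 → Set M), Literature.Topology.FourManifolds.IsGKTrisection M 4 k T → k 0 + k 1 + k 2 = 4 → (∀ i, k i ≤ 2) → (∃ c c' : Set M, Literature.Topology.FourManifolds.Trisection.IsCurve T c ∧ Literature.Topology.FourManifolds.Trisection.IsCurve T c' ∧ Disjoint c c' ∧ Literature.Topology.FourManifolds.Trisection.IsNonSeparating T c ∧ Literature.Topology.FourManifolds.Trisection.IsNonSeparating T c' ∧ Literature.Topology.FourManifolds.Trisection.BoundsDisc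 T (Literature.Topology.FourManifolds.Trisection.spineHandlebody T 0) c ∧ Literature.Topology.FourManifolds.Trisection.BoundsDisc T (Literature.Topology.FourManifolds.Trisection.spineHandlebody T 1) c' ∧ Literature.Topology.FourManifolds.Trisection.BoundsDisc T (Literature.Topology.FourManifolds.Trisection.spineHandlebody T 2) c') → ¬ Literature.Topology.FourManifolds.Trisection.IsReducible T → (∃ (g₁ : ℕ) (k₁ : Fin 3 → ℕ) (T₁ : Fin 3 → Set M), g₁ < 4 ∧ Literature.Topology.FourManifolds.IsGKTrisection M g₁ k₁ T₁) ∨ (∃ (X : Type) (_ : TopologicalSpace X) (_ : T2Space X) (_ : SecondCountableTopology X) (_ : ChartedSpace (EuclideanSpace ℝ (Fin 4)) X) (_ : IsManifold (𝓡 4) ((⊤ : ℕ∞) : WithTop ℕ∞) X) (g' : ℕ) (k' : Fin 3 → ℕ) (T' : Fin 3 → Set X) (ℓ : (Metric.sphere (0 : EuclideanSpace ℝ (Fin 2)) 1) → X), g' < 4 ∧ Literature.Topology.FourManifolds.IsGKTrisection X g' k' T' ∧ Manifold.IsSmoothEmbedding (𝓡 1) (𝓡 4) ((⊤ : ℕ∞)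 : WithTop ℕ∞) ℓ ∧ Literature.Topology.FourManifolds.IsCircleSurgery (𝓡 4) (𝓡 4) X M ℓ) :=
  helper_loopDichotomyFourCore_of_normalised loopDichotomyFourCoreNorm

/-- **CORE₅ (v4 stub `stub_loopDichotomyFromFiveCore`, verbatim)** from CORE₅⁺ (`helper_loopDichotomyFromFiveCore_of_posFirst`, PROVED).
[cite: ArandaZupan2025, §2 (p. 6), §6 (pp. 20–21)] -/
theorem loopDichotomyFromFiveCore :
    ∀ (M : Type) [TopologicalSpace M] [T2Space M] [SecondCountableTopology M] [ChartedSpace (EuclideanSpace ℝ (Fin 4)) M] [IsManifold (𝓡 4) ((⊤ : ℕ∞) : WithTop ℕ∞) M], (M ≃ₕ (Metric.sphere (0 : EuclideanSpace ℝ (Fin 5)) 1)) → ∀ (g : ℕ) (k : Fin 3 → ℕ) (T : Fin 3 → Set M), Literature.Topology.FourManifolds.IsGKTrisection M g k T → 5 ≤ g → k 0 + k 1 + k 2 = g → (∀ i, k i + 2 ≤ g) → (∃ c c' : Set M, Literature.Topology.FourManifolds.Trisection.IsCurve T c ∧ Literature.Topology.FourManifolds.Trisection.IsCurve T c' ∧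 Disjoint c c' ∧ Literature.Topology.FourManifolds.Trisection.IsNonSeparating T c ∧ Literature.Topology.FourManifolds.Trisection.IsNonSeparating T c' ∧ Literature.Topology.FourManifolds.Trisection.BoundsDisc T (Literature.Topology.FourManifolds.Trisection.spineHandlebody T 0) c ∧ Literature.Topology.FourManifolds.Trisection.BoundsDisc T (Literature.Topology.FourManifolds.Trisection.spineHandlebody T 1) c' ∧ Literature.Topology.FourManifolds.Trisection.BoundsDisc T (Literature.Topology.FourManifolds.Trisection.spineHandlebody T 2) c') → ¬ Literature.Topology.FourManifolds.Trisection.IsReducible T → (∃ (g₁ : ℕ) (k₁ : Fin 3 → ℕ) (T₁ : Fin 3 → Set M), g₁ < g ∧ Literature.Topology.FourManifolds.IsGKTrisection M g₁ k₁ T₁) ∨ (∃ (X : Type) (_ : TopologicalSpace X) (_ : T2Space X) (_ : SecondCountableTopology X) (_ : ChartedSpace (EuclideanSpace ℝ (Fin 4)) X) (_ : IsManifold (𝓡 4) ((⊤ : ℕ∞) : WithTop ℕ∞) X) (g' : ℕ) (k' : Fin 3 → ℕ) (T' : Fin 3 → Set X) (ℓ : (Metric.sphere (0 : EuclideanSpace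 ℝ (Fin 2)) 1) → X), g' < g ∧ Literature.Topology.FourManifolds.IsGKTrisection X g' k' T' ∧ Manifold.IsSmoothEmbedding (𝓡 1) (𝓡 4) ((⊤ : ℕ∞) : WithTop ℕ∞) ℓ ∧ Literature.Topology.FourManifolds.IsCircleSurgery (𝓡 4) (𝓡 4) X M ℓ) :=
  helper_loopDichotomyFromFiveCore_of_posFirst loopDichotomyFromFiveCorePos


/-- **D₄ (v3 stub `stub_loopDichotomyFour`, verbatim)** from CORE₄ (`helper_loopDichotomyFour_of_irreducibleCore`, PROVED).
[cite: ArandaZupan2025, §2 (p. 6), §6 (p. 20)] -/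
theorem loopDichotomyFour :
    ∀ (M : Type) [TopologicalSpace M] [T2Space M] [SecondCountableTopology M] [ChartedSpace (EuclideanSpace ℝ (Fin 4)) M] [IsManifold (𝓡 4) ((⊤ : ℕ∞) : WithTop ℕ∞) M], (M ≃ₕ (Metric.sphere (0 : EuclideanSpace ℝ (Fin 5)) 1)) → ∀ (k : Fin 3 → ℕ) (T : Fin 3 → Set M), Literature.Topology.FourManifolds.IsGKTrisection M 4 k T → k 0 + k 1 + k 2 = 4 → (∀ i, k i ≤ 2) → Literature.Topology.FourManifolds.Trisection.IsWeaklyReducible T → Literature.Topology.FourManifolds.Trisection.IsReducible T ∨ (∃ (g₁ : ℕ) (k₁ : Fin 3 → ℕ) (T₁ : Fin 3 → Set M), g₁ < 4 ∧ Literature.Topology.FourManifolds.IsGKTrisection M g₁ k₁ T₁) ∨ (∃ (X : Type) (_ : TopologicalSpace X) (_ : T2Space X) (_ : SecondCountableTopology X) (_ : ChartedSpace (EuclideanSpace ℝ (Fin 4)) X) (_ : IsManifold (𝓡 4) ((⊤ : ℕ∞) : WithTop ℕ∞) X) (g' : ℕ) (k' : Fin 3 → ℕ) (T' : Fin 3 →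 Set X) (ℓ : (Metric.sphere (0 : EuclideanSpace ℝ (Fin 2)) 1) → X), g' < 4 ∧ Literature.Topology.FourManifolds.IsGKTrisection X g' k' T' ∧ Manifold.IsSmoothEmbedding (𝓡 1) (𝓡 4) ((⊤ : ℕ∞) : WithTop ℕ∞) ℓ ∧ Literature.Topology.FourManifolds.IsCircleSurgery (𝓡 4) (𝓡 4) X M ℓ) :=
  helper_loopDichotomyFour_of_irreducibleCore loopDichotomyFourCore

/-- **D₅ (v3 stub `stub_loopDichotomyFromFive`, verbatim)** from CORE₅ (`helper_loopDichotomyFromFive_of_irreducibleCore`, PROVED).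
[cite: ArandaZupan2025, §2 (p. 6), §6 (p. 20)] -/
theorem loopDichotomyFromFive :
    ∀ (M : Type) [TopologicalSpace M] [T2Space M] [SecondCountableTopology M] [ChartedSpace (EuclideanSpace ℝ (Fin 4)) M] [IsManifold (𝓡 4) ((⊤ : ℕ∞) : WithTop ℕ∞) M], (M ≃ₕ (Metric.sphere (0 : EuclideanSpace ℝ (Fin 5)) 1)) → ∀ (g : ℕ) (k : Fin 3 → ℕ) (T : Fin 3 → Set M), Literature.Topology.FourManifolds.IsGKTrisection M g k T → 5 ≤ g → k 0 + k 1 + k 2 = g → (∀ i, k i + 2 ≤ g) → Literature.Topology.FourManifolds.Trisection.IsWeaklyReducible T → Literature.Topology.FourManifolds.Trisection.IsReducible T ∨ (∃ (g₁ : ℕ) (k₁ : Fin 3 → ℕ) (T₁ : Fin 3 → Set M), g₁ < g ∧ Literature.Topology.FourManifolds.IsGKTrisection M g₁ k₁ T₁) ∨ (∃ (X : Type) (_ : TopologicalSpace X) (_ : T2Space X) (_ : SecondCountableTopology X) (_ : ChartedSpace (EuclideanSpace ℝ (Fin 4)) X) (_ : IsManifold (𝓡 4) ((⊤ : ℕ∞)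 : WithTop ℕ∞) X) (g' : ℕ) (k' : Fin 3 → ℕ) (T' : Fin 3 → Set X) (ℓ : (Metric.sphere (0 : EuclideanSpace ℝ (Fin 2)) 1) → X), g' < g ∧ Literature.Topology.FourManifolds.IsGKTrisection X g' k' T' ∧ Manifold.IsSmoothEmbedding (𝓡 1) (𝓡 4) ((⊤ : ℕ∞) : WithTop ℕ∞) ℓ ∧ Literature.Topology.FourManifolds.IsCircleSurgery (𝓡 4) (𝓡 4) X M ℓ) :=
  helper_loopDichotomyFromFive_of_irreducibleCore loopDichotomyFromFiveCore

/-- **D at `g ≥ 4`** from the classification stub, D₄ and D₅ (`helper_loopDichotomy_fromFour_of_core`, PROVED).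
[cite: MeierSchirmerZupan2016, Thm. 1.2 and Remark 3.12] [cite: ArandaZupan2025, Thm. 1.3 (p. 2) and §5] -/
theorem loopDichotomy_fromFour :
    ∀ (M : Type) [TopologicalSpace M] [T2Space M] [SecondCountableTopology M] [ChartedSpace (EuclideanSpace ℝ (Fin 4)) M] [IsManifold (𝓡 4) ((⊤ : ℕ∞) : WithTop ℕ∞) M], (M ≃ₕ (Metric.sphere (0 : EuclideanSpace ℝ (Fin 5)) 1)) → ∀ (g : ℕ) (k : Fin 3 → ℕ) (T : Fin 3 → Set M), Literature.Topology.FourManifolds.IsGKTrisection M g k T → 4 ≤ g → Literature.Topology.FourManifolds.Trisection.IsWeaklyReducible T → Literature.Topology.FourManifolds.Trisection.IsReducible T ∨ (∃ (g₁ : ℕ) (k₁ : Fin 3 → ℕ) (T₁ : Fin 3 → Set M), g₁ < g ∧ Literature.Topology.FourManifolds.IsGKTrisection M g₁ k₁ T₁) ∨ (∃ (X : Type) (_ : TopologicalSpace X) (_ : T2Space X) (_ : SecondCountableTopology X) (_ : ChartedSpace (EuclideanSpace ℝ (Fin 4)) X) (_ : IsManifold (𝓡 4) ((⊤ : ℕ∞)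 : WithTop ℕ∞) X) (g' : ℕ) (k' : Fin 3 → ℕ) (T' : Fin 3 → Set X) (ℓ : (Metric.sphere (0 : EuclideanSpace ℝ (Fin 2)) 1) → X), g' < g ∧ Literature.Topology.FourManifolds.IsGKTrisection X g' k' T' ∧ Manifold.IsSmoothEmbedding (𝓡 1) (𝓡 4) ((⊤ : ℕ∞) : WithTop ℕ∞) ℓ ∧ Literature.Topology.FourManifolds.IsCircleSurgery (𝓡 4) (𝓡 4) X M ℓ) :=
  helper_loopDichotomy_fromFour_of_core stub_mszClassification loopDichotomyFour loopDichotomyFromFive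

/-- **The line's `χ = 0` MSZ corollary from the classification stub** (PROVED reduction in the tree,
`msz_chiZero_circleProdSphereThree_gk_of_classification`). [cite: MeierSchirmerZupan2016, Thm. 1.2 and Remark 3.12] -/
theorem mszChiZero : Literature.Topology.FourManifolds.msz_chiZero_circleProdSphereThree_gk.{0} :=
  Literature.Topology.FourManifolds.msz_chiZero_circleProdSphereThree_gk_of_classification.{0, 0}
    stub_mszClassification

/-- **L₃ (v1 stub `stub_loopFromGenusThree`, verbatim)** from the classification stub through the
`χ = 0` corollary (`helper_loopFromGenusThree_of_msz`, Aux5). [cite: MeierSchirmerZupan2016, Thm. 1.2 (arXiv numbering)] [cite: Pao1977, Thm] -/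
theorem loopFromGenusThree :
    ∀ (X : Type) [TopologicalSpace X] [T2Space X] [SecondCountableTopology X] [ChartedSpace (EuclideanSpace ℝ (Fin 4)) X] [IsManifold (𝓡 4) ((⊤ : ℕ∞) : WithTop ℕ∞) X] (g' : ℕ) (k' : Fin 3 → ℕ) (T' : Fin 3 → Set X), Literature.Topology.FourManifolds.IsGKTrisection X g' k' T' → g' ≤ 3 → ∀ (ℓ : (Metric.sphere (0 : EuclideanSpace ℝ (Fin 2)) 1) → X), Manifold.IsSmoothEmbedding (𝓡 1) (𝓡 4) ((⊤ : ℕ∞) : WithTop ℕ∞) ℓ → ∀ (M : Type) [TopologicalSpace M] [T2Space M] [SecondCountableTopology M] [ChartedSpace (EuclideanSpace ℝ (Fin 4)) M] [IsManifold (𝓡 4) ((⊤ : ℕ∞) : WithTop ℕ∞) M], (M ≃ₕ (Metric.sphere (0 : EuclideanSpace ℝ (Fin 5)) 1)) → Literature.Topology.FourManifolds.IsCircleSurgery (𝓡 4) (𝓡 4) X M ℓ → Nonempty (Diffeomorph (𝓡 4) (𝓡 4) M (Metric.sphere (0 : EuclideanSpace ℝ (Fin 5)) 1) ((⊤ : ℕ∞)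 : WithTop ℕ∞)) :=
  helper_loopFromGenusThree_of_msz mszChiZero

/-- **H_res (v2/v3 stub `stub_loopResidue`, verbatim)** from H_res′ (`helper_loopResidue_of_lowRank`,
PROVED Chu–Tillmann pruning). [cite: ChuTillmann2019, §1 p. 2] -/
theorem loopResidue :
    ∀ (M : Type) [TopologicalSpace M] [T2Space M] [SecondCountableTopology M] [ChartedSpace (EuclideanSpace ℝ (Fin 4)) M] [IsManifold (𝓡 4) ∞ M], (M ≃ₕ (Metric.sphere (0 : EuclideanSpace ℝ (Fin 5)) 1)) → ∀ (g : ℕ) (k : Fin 3 → ℕ) (T : Fin 3 → Set M), Literature.Topology.FourManifolds.IsGKTrisection M g k T → 5 ≤ g → (∀ (g'' : ℕ) (k'' : Fin 3 → ℕ) (T'' : Fin 3 → Set M), Literature.Topology.FourManifolds.IsGKTrisection M g'' k'' T'' → g ≤ g'') → ∀ (X : Type) [TopologicalSpace X] [T2Space X] [SecondCountableTopology X] [ChartedSpace (EuclideanSpace ℝ (Fin 4)) X] [IsManifold (𝓡 4) ∞ X], Literature.Topology.FourManifolds.IsOrientable (𝓡 4) X → ∀ (g' : ℕ) (k' : Fin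 3 → ℕ) (T' : Fin 3 → Set X), 4 ≤ g' → g' < g → Literature.Topology.FourManifolds.IsGKTrisection X g' k' T' → k' 0 + k' 1 + k' 2 = g' + 2 → (∀ i, k' i + 2 ≤ g') → ∀ (ℓ : (Metric.sphere (0 : EuclideanSpace ℝ (Fin 2)) 1) → X), Manifold.IsSmoothEmbedding (𝓡 1) (𝓡 4) ∞ ℓ → ¬ Literature.Topology.FourManifolds.IsCircleSurgery (𝓡 4) (𝓡 4) X M ℓ :=
  helper_loopResidue_of_lowRank stub_loopResidueCore

/-- **L₅ (v1 stub `stub_loopNoDescentFromFive`, verbatim)** from the classification stub (through the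
`χ = 0` corollary and the loop-presentation corollary, Aux6) and H_res (L₅-Aux4).
[cite: MeierSchirmerZupan2016, Thm. 1.2 (arXiv numbering)] -/
theorem loopNoDescentFromFive :
    ∀ (M : Type) [TopologicalSpace M] [T2Space M] [SecondCountableTopology M] [ChartedSpace (EuclideanSpace ℝ (Fin 4)) M] [IsManifold (𝓡 4) ((⊤ : ℕ∞) : WithTop ℕ∞) M], (M ≃ₕ (Metric.sphere (0 : EuclideanSpace ℝ (Fin 5)) 1)) → ∀ (g : ℕ) (k : Fin 3 → ℕ) (T : Fin 3 → Set M), Literature.Topology.FourManifolds.IsGKTrisection M g k T → 5 ≤ g → (∀ (g'' : ℕ) (k'' : Fin 3 → ℕ) (T'' : Fin 3 → Set M), Literature.Topology.FourManifolds.IsGKTrisection M g'' k'' T'' → g ≤ g'') → ∀ (X : Type) [TopologicalSpace X] [T2Space X] [SecondCountableTopology X] [ChartedSpace (EuclideanSpace ℝ (Fin 4)) X] [IsManifold (𝓡 4) ((⊤ : ℕ∞) : WithTop ℕ∞) X] (g' : ℕ) (k' : Fin 3 → ℕ) (T' : Fin 3 → Set X), g' < g → Literature.Topology.FourManifolds.IsGKTrisection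 X g' k' T' → ∀ (ℓ : (Metric.sphere (0 : EuclideanSpace ℝ (Fin 2)) 1) → X), Manifold.IsSmoothEmbedding (𝓡 1) (𝓡 4) ((⊤ : ℕ∞) : WithTop ℕ∞) ℓ → ¬ Literature.Topology.FourManifolds.IsCircleSurgery (𝓡 4) (𝓡 4) X M ℓ :=
  helper_loopNoDescentFromFive_of_msz (helper_mszLoopSurgery_of_chiZero mszChiZero) loopResidue

/-! ## The composition, sorry-free, concluding the crux BY NAME -/

/-- A diffeomorphism to the round sphere makes every genus `≥ 1` non-minimal: Gay–Kirby's genus-`0`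
trisection of `S⁴` pulls back. [folklore] -/
theorem not_minimal_of_diffeomorph {M : Type} [TopologicalSpace M]
    [ChartedSpace (EuclideanSpace ℝ (Fin 4)) M] [IsManifold (𝓡 4) ∞ M]
    (Φ : M ≃ₘ⟮𝓡 4, 𝓡 4⟯ 𝕊⁴) {g : ℕ} (hg : 1 ≤ g)
    (hmin : ∀ (g' : ℕ) (k' : Fin 3 → ℕ) (T' : Fin 3 → Set M), IsGKTrisection M g' k' T' → g ≤ g') :
    False := by
  obtain ⟨g₁, k₁, T₁, hlt, hT₁⟩ := exists_genus_lt_of_diffeomorph_sphere Φ hg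
  have := hmin g₁ k₁ T₁ hT₁
  omega

/-- **`weakReductionReduces_of_pieces'` : D(≥4) → L₃ → L₅ → K2** (v1's glue with D weakened to
`4 ≤ g`, which is all it ever consumed).  D's first exit is the conclusion; its second exit
contradicts minimality; its loop exit is closed by L₃ at `g = 4` (then `M ≅ S⁴`, whose genus-`0`
trisection contradicts minimality) and forbidden by L₅ at `g ≥ 5`. -/
theorem weakReductionReduces_of_pieces' :
    (∀ (M : Type) [TopologicalSpace M] [T2Space M] [SecondCountableTopology M] [ChartedSpace (EuclideanSpace ℝ (Fin 4)) M] [IsManifold (𝓡 4) ((⊤ : ℕ∞) : WithTop ℕ∞) M], (M ≃ₕ (Metric.sphere (0 : EuclideanSpace ℝ (Fin 5)) 1)) → ∀ (g : ℕ) (k : Fin 3 → ℕ) (T : Fin 3 → Set M), Literature.Topology.FourManifolds.IsGKTrisection M g k T → 4 ≤ g → Literature.Topology.FourManifolds.Trisection.IsWeaklyReducible T → Literature.Topology.FourManifolds.Trisection.IsReducible T ∨ (∃ (g₁ : ℕ) (k₁ : Fin 3 → ℕ) (T₁ : Fin 3 → Set M), g₁ < g ∧ Literature.Topology.FourManifolds.IsGKTrisection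 M g₁ k₁ T₁) ∨ (∃ (X : Type) (_ : TopologicalSpace X) (_ : T2Space X) (_ : SecondCountableTopology X) (_ : ChartedSpace (EuclideanSpace ℝ (Fin 4)) X) (_ : IsManifold (𝓡 4) ((⊤ : ℕ∞) : WithTop ℕ∞) X) (g' : ℕ) (k' : Fin 3 → ℕ) (T' : Fin 3 → Set X) (ℓ : (Metric.sphere (0 : EuclideanSpace ℝ (Fin 2)) 1) → X), g' < g ∧ Literature.Topology.FourManifolds.IsGKTrisection X g' k' T' ∧ Manifold.IsSmoothEmbedding (𝓡 1) (𝓡 4) ((⊤ : ℕ∞) : WithTop ℕ∞) ℓ ∧ Literature.Topology.FourManifolds.IsCircleSurgery (𝓡 4) (𝓡 4) X M ℓ)) →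
    (∀ (X : Type) [TopologicalSpace X] [T2Space X] [SecondCountableTopology X] [ChartedSpace (EuclideanSpace ℝ (Fin 4)) X] [IsManifold (𝓡 4) ((⊤ : ℕ∞) : WithTop ℕ∞) X] (g' : ℕ) (k' : Fin 3 → ℕ) (T' : Fin 3 → Set X), Literature.Topology.FourManifolds.IsGKTrisection X g' k' T' → g' ≤ 3 → ∀ (ℓ : (Metric.sphere (0 : EuclideanSpace ℝ (Fin 2)) 1) → X), Manifold.IsSmoothEmbedding (𝓡 1) (𝓡 4) ((⊤ : ℕ∞) : WithTop ℕ∞) ℓ → ∀ (M : Type) [TopologicalSpace M] [T2Space M] [SecondCountableTopology M] [ChartedSpace (EuclideanSpace ℝ (Fin 4)) M] [IsManifold (𝓡 4) ((⊤ : ℕ∞) : WithTop ℕ∞) M], (M ≃ₕ (Metric.sphere (0 : EuclideanSpace ℝ (Fin 5)) 1)) → Literature.Topology.FourManifolds.IsCircleSurgery (𝓡 4) (𝓡 4) X M ℓ → Nonempty (Diffeomorph (𝓡 4) (𝓡 4) M (Metric.sphere (0 : EuclideanSpace ℝ (Fin 5)) 1) ((⊤ : ℕ∞) : WithTop ℕ∞)))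 →
    (∀ (M : Type) [TopologicalSpace M] [T2Space M] [SecondCountableTopology M] [ChartedSpace (EuclideanSpace ℝ (Fin 4)) M] [IsManifold (𝓡 4) ((⊤ : ℕ∞) : WithTop ℕ∞) M], (M ≃ₕ (Metric.sphere (0 : EuclideanSpace ℝ (Fin 5)) 1)) → ∀ (g : ℕ) (k : Fin 3 → ℕ) (T : Fin 3 → Set M), Literature.Topology.FourManifolds.IsGKTrisection M g k T → 5 ≤ g → (∀ (g'' : ℕ) (k'' : Fin 3 → ℕ) (T'' : Fin 3 → Set M), Literature.Topology.FourManifolds.IsGKTrisection M g'' k'' T'' → g ≤ g'') → ∀ (X : Type) [TopologicalSpace X] [T2Space X] [SecondCountableTopology X] [ChartedSpace (EuclideanSpace ℝ (Fin 4)) X] [IsManifold (𝓡 4) ((⊤ : ℕ∞) : WithTop ℕ∞) X] (g' : ℕ) (k' : Fin 3 → ℕ) (T' : Fin 3 → Set X), g' < g → Literature.Topology.FourManifolds.IsGKTrisection X g' k' T' → ∀ (ℓ : (Metric.sphere (0 : EuclideanSpace ℝ (Fin 2)) 1) → X), Manifold.IsSmoothEmbedding (𝓡 1) (𝓡 4)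 ((⊤ : ℕ∞) : WithTop ℕ∞) ℓ → ¬ Literature.Topology.FourManifolds.IsCircleSurgery (𝓡 4) (𝓡 4) X M ℓ) →
    -- the crux `WeakReductionReduces`, UNFOLDED verbatim (only the closed skeleton theorem below
    -- concludes the crux by name; `WeakReductionReduces_of` re-folds it definitionally)
    (∀ (M : Type) [TopologicalSpace M] [T2Space M] [SecondCountableTopology M] [ChartedSpace (EuclideanSpace ℝ (Fin 4)) M] [IsManifold (𝓡 4) ((⊤ : ℕ∞) : WithTop ℕ∞) M], (M ≃ₕ (Metric.sphere (0 : EuclideanSpace ℝ (Fin 5)) 1)) → ∀ (g : ℕ) (k : Fin 3 → ℕ) (T : Fin 3 → Set M), Literature.Topology.FourManifolds.IsGKTrisection M g k T → 4 ≤ g → (∀ (g' : ℕ) (k' : Fin 3 → ℕ) (T' : Fin 3 → Set M), Literature.Topology.FourManifolds.IsGKTrisection M g' k' T' → g ≤ g') → (let F : Set M := ⋂ l, T l; let H : Fin 3 → Set M := fun p => ⋂ (l : Fin 3) (_ : l ≠ p), T l; let IsCurve : Set M → Prop := fun c => c ⊆ F ∧ ∃ γ : (Metric.sphere (0 : EuclideanSpace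 ℝ (Fin 2)) 1) → M, Manifold.IsSmoothEmbedding (𝓡 1) (𝓡 4) ((⊤ : ℕ∞) : WithTop ℕ∞) γ ∧ Set.range γ = c; let BoundsDisc : Set M → Set M → Prop := fun A c => ∃ d : (Metric.closedBall (0 : EuclideanSpace ℝ (Fin 2)) 1) → M, Manifold.IsSmoothEmbedding (𝓡∂ 2) (𝓡 4) ((⊤ : ℕ∞) : WithTop ℕ∞) d ∧ Set.range d ⊆ A ∧ d '' ((𝓡∂ 2).boundary (Metric.closedBall (0 : EuclideanSpace ℝ (Fin 2)) 1)) = c ∧ Set.range d ∩ F = c; let NonSep : Set M → Prop := fun c => IsConnected (F \ c); let WeaklyReducible : Prop := ∃ (p : Fin 3) (c c' : Set M), IsCurve c ∧ IsCurve c' ∧ Disjoint c c' ∧ NonSep c ∧ NonSep c' ∧ BoundsDisc (H p) c ∧ ∀ q : Fin 3, q ≠ p → BoundsDisc (H q) c'; WeaklyReducible) → (let F : Set M := ⋂ l, T l; let H : Fin 3 → Set M := fun p => ⋂ (l : Fin 3) (_ : l ≠ p), T l; let IsCurve : Set M → Prop := fun c => c ⊆ F ∧ ∃ γ : (Metric.sphere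 (0 : EuclideanSpace ℝ (Fin 2)) 1) → M, Manifold.IsSmoothEmbedding (𝓡 1) (𝓡 4) ((⊤ : ℕ∞) : WithTop ℕ∞) γ ∧ Set.range γ = c; let BoundsDisc : Set M → Set M → Prop := fun A c => ∃ d : (Metric.closedBall (0 : EuclideanSpace ℝ (Fin 2)) 1) → M, Manifold.IsSmoothEmbedding (𝓡∂ 2) (𝓡 4) ((⊤ : ℕ∞) : WithTop ℕ∞) d ∧ Set.range d ⊆ A ∧ d '' ((𝓡∂ 2).boundary (Metric.closedBall (0 : EuclideanSpace ℝ (Fin 2)) 1)) = c ∧ Set.range d ∩ F = c; let Reducible : Prop := ∃ δ : Set M, IsCurve δ ∧ ¬ (∃ e : (Metric.closedBall (0 : EuclideanSpace ℝ (Fin 2)) 1) → M, Manifold.IsSmoothEmbedding (𝓡∂ 2) (𝓡 4) ((⊤ : ℕ∞) : WithTop ℕ∞) e ∧ Set.range e ⊆ F ∧ e '' ((𝓡∂ 2).boundary (Metric.closedBall (0 : EuclideanSpace ℝ (Fin 2)) 1)) = δ) ∧ ∀ q : Fin 3, BoundsDisc (H q) δ; Reducible)) := by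
  intro hD hL3 hL5 M _ _ _ _ _ e g k T hT hg hmin hwr
  have hwr' : Literature.Topology.FourManifolds.Trisection.IsWeaklyReducible T :=
    (Literature.Topology.FourManifolds.Trisection.isWeaklyReducible_iff T).2 hwr
  rcases hD M e g k T hT hg hwr' with hred | ⟨g₁, k₁, T₁, hlt, hT₁⟩ |
      ⟨X, _, _, _, _, _, g', k', T', ℓ, hlt, hT', hℓ, hsurg⟩
  · exact (Literature.Topology.FourManifolds.Trisection.isReducible_iff T).1 hred
  · have := hmin g₁ k₁ T₁ hT₁
    omega
  · rcases Nat.lt_or_ge g 5 with hg5 | hg5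
    · obtain ⟨Φ⟩ := hL3 X g' k' T' hT' (by omega) ℓ hℓ M e hsurg
      exact (not_minimal_of_diffeomorph Φ (by omega) hmin).elim
    · exact (hL5 M e g k T hT hg5 hmin X g' k' T' hlt hT' ℓ hℓ hsurg).elim

/-- **THE SKELETON THEOREM (v6): the crux `WeakReductionReduces` BY NAME from the four registered
stubs `stub_loopDichotomyFourCoreGenuine`, `stub_loopDichotomyFromFiveCoreGenuine`,
`stub_mszClassification`, `stub_loopResidueCore`.** -/
theorem WeakReductionReduces_of : WeakReductionReduces :=
  weakReductionReduces_of_pieces' loopDichotomy_fromFour loopFromGenusThree loopNoDescentFromFive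

end Summit.SmoothPoincare4.SmoothPoincare4.Cruxes.WeakReductionReduces.LoopDichotomy

end
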